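import Mathlib.GroupTheory.Solvable
import Mathlib.Algebra.Group.Subgroup.Pointwise
import Mathlib.Data.Fintype.Pi
import Mathlib.SetTheory.Cardinal.Finite
import HarnessLib

/-!
# Gaschütz lifting: generators of `G/N` lift to generators of `G` unless they generate a
# complement (Gaschütz 1955)

Topic `Literature/GroupTheory/Solvable`, namespace `Literature.GroupTheory.Solvable`.  THEOREMS
ONLY (no definition, no named fact).  Everything here is elementary finite group theory over
Mathlib; it is the group-theoretic half of the proof that the absolute Galois group of a `p`-adic
local field is topologically finitely generated (consumer:
`Literature/AnabelianGeometry/AbsoluteAnabelian/MLFGaloisFiniteQuotientGenerators.lean`).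

Let `N ⊴ G` be an **abelian minimal normal** subgroup of a group `G` and let `g : ι → G` be a family
whose images generate `G/N` (`closure (range g) ⊔ N = ⊤`).  For `t : ι → N` put
`H_t := closure {g i · t i}`.  W. Gaschütz, *Zu einem von B. H. und H. Neumann gestellten Problem*,
Math. Nachr. 14 (1955) 249–252, proves that the number of `t` with `H_t = G` does not depend on
the generating family of `G/N`; we formalise the inequality half of the argument:

* `inf_eq_bot_of_sup_eq_top_of_ne_top` — if `H ⊔ N = ⊤` and `H ≠ ⊤` then `H ⊓ N = ⊥`
  (`H ⊓ N` is normalised by `H` and, `N` being abelian, by `N`; minimality);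
* `existsUnique_mul_inv_mem` — along a complement `H` (`H ⊔ N = ⊤`, `H ⊓ N = ⊥`) every `a : G`
  factors uniquely as `a = h · n`;
* `natCard_badLifts_le_natCard_crossedHom` — **the lifts `t` with `H_t ≠ ⊤` inject into the
  crossed homomorphisms `c : G → N`, `c (a b) = c a · (a · c b · a⁻¹)`** (`t ↦ H_t` is injective on
  such `t`, and a complement `H` is recovered from its crossed homomorphism
  `a ↦ (N-part of a⁻¹)` as `{a | c a⁻¹ = 1}`);
* `exists_closure_eq_top_of_natCard_crossedHom_lt` — **Gaschütz lifting**: if there are fewer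
  crossed homomorphisms `G → N` than `|N| ^ |ι|`, some lift `(g i · t i)` generates `G`.

## References

* W. Gaschütz, *Zu einem von B. H. und H. Neumann gestellten Problem*, Math. Nachr. 14 (1955),
  249–252. [Gaschutz1955]
* A. Lubotzky, D. Segal, *Subgroup Growth*, Birkhäuser PM 212 (2003) (Gaschütz' lemma on
  lifting generators, used throughout Ch. 1). [LubotzkySegal2003]
* J. J. Rotman, *An Introduction to the Theory of Groups*, 4th ed., GTM 148 (1995), Lemma 7.20
  (complements and unique factorisation). [Rotman1995]
-/

namespace Literature.GroupTheory.Solvable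

variable {G : Type} [Group G] {N : Subgroup G} [N.Normal]

/-! ### A proper supplement of an abelian minimal normal subgroup is a complement -/

/-- If `N ⊴ G` is abelian and minimal normal, `H ⊔ N = ⊤` and `H ≠ ⊤`, then `H ⊓ N = ⊥`: writing
any `x ∈ G` as `h · n` (`G = H N`), `x (H ⊓ N) x⁻¹ = h (H ⊓ N) h⁻¹ ⊆ H ⊓ N` because `N` is abelian,
so `H ⊓ N ⊴ G`; it is not `N` (else `N ≤ H = ⊤`), hence it is `⊥`.
[cite: Gaschutz1955, Satz 1 (proof), p. 250] -/
theorem inf_eq_bot_of_sup_eq_top_of_ne_top [IsMulCommutative N]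
    (hmin : ∀ K : Subgroup G, K.Normal → K ≤ N → K = ⊥ ∨ K = N)
    {H : Subgroup G} (hHN : H ⊔ N = ⊤) (hH : H ≠ ⊤) : H ⊓ N = ⊥ := by
  have hnorm : (H ⊓ N).Normal := by
    refine ⟨fun x hx y => ?_⟩
    have hy : y ∈ ((H ⊔ N : Subgroup G) : Set G) := by rw [hHN]; exact Subgroup.mem_top y
    rw [Subgroup.mul_normal] at hy
    obtain ⟨h, hh, n, hn, rfl⟩ := Set.mem_mul.mp hy
    obtain ⟨hxH, hxN⟩ := Subgroup.mem_inf.mp hx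
    -- `n x n⁻¹ = x` since `N` is abelian
    have hcomm : n * x * n⁻¹ = x := by
      have h1 : (⟨n, hn⟩ : N) * ⟨x, hxN⟩ = ⟨x, hxN⟩ * ⟨n, hn⟩ :=
        IsMulCommutative.is_comm.comm _ _
      have h2 : n * x = x * n := by simpa using congrArg Subtype.val h1
      rw [h2, mul_inv_cancel_right]
    have hrew : h * n * x * (h * n)⁻¹ = h * x * h⁻¹ := by
      rw [mul_inv_rev, mul_assoc h n x, ← mul_assoc (h * (n * x)), mul_assoc h (n * x),
        hcomm]
    rw [hrew]
    exact Subgroup.mem_inf.mpr ⟨H.mul_mem (H.mul_mem hh hxH) (H.inv_mem hh),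
      ‹N.Normal›.conj_mem x hxN h⟩
  rcases hmin (H ⊓ N) hnorm inf_le_right with hbot | hall
  · exact hbot
  · exfalso
    apply hH
    have hNH : N ≤ H := by rw [← hall]; exact inf_le_left
    rw [← hHN, sup_eq_left.mpr hNH]

/-! ### Unique factorisation along a complement -/

/-- Along a complement `H` of `N` (`H ⊔ N = ⊤`, `H ⊓ N = ⊥`) every `a : G` has a unique `n ∈ N`
with `a n⁻¹ ∈ H` ("every element `g ∈ G` has a unique expression `g = ax`, `a ∈ K`, `x ∈ Q`").
[cite: Rotman1995, Lemma 7.20 (ii)] -/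
theorem existsUnique_mul_inv_mem {H : Subgroup G} (hHN : H ⊔ N = ⊤) (hbot : H ⊓ N = ⊥) (a : G) :
    ∃! n : N, a * (n : G)⁻¹ ∈ H := by
  have ha : a ∈ ((H ⊔ N : Subgroup G) : Set G) := by rw [hHN]; exact Subgroup.mem_top a
  rw [Subgroup.mul_normal] at ha
  obtain ⟨h, hh, n, hn, rfl⟩ := Set.mem_mul.mp ha
  refine ⟨⟨n, hn⟩, by simpa using hh, fun m hm => ?_⟩
  -- `(h n m⁻¹)⁻¹ (h n n⁻¹) = m n⁻¹ ∈ H ⊓ N = ⊥`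
  have hmem : (m : G) * n⁻¹ ∈ H ⊓ N := by
    refine Subgroup.mem_inf.mpr ⟨?_, N.mul_mem m.2 (N.inv_mem hn)⟩
    have h1 : (h * n * (m : G)⁻¹)⁻¹ * (h * n * n⁻¹) ∈ H :=
      H.mul_mem (H.inv_mem hm) (by simpa using hh)
    simpa [mul_inv_rev, mul_assoc] using h1
  rw [hbot, Subgroup.mem_bot] at hmem
  exact Subtype.ext (mul_inv_eq_one.mp hmem)

omit [N.Normal] in
/-- The `N`-part along a complement `H` is `1` exactly on `H` (the retraction `G → G` with kernel
the normal factor, Rotman Lemma 7.20 (iv), read on the other factor). [cite: Rotman1995, Lemma 7.20 (iv)] -/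
theorem mul_inv_mem_iff_of_complement {H : Subgroup G} (hbot : H ⊓ N = ⊥) {a : G} {n : N}
    (hn : a * (n : G)⁻¹ ∈ H) : a ∈ H ↔ n = 1 := by
  constructor
  · intro ha
    have hmem : (n : G) ∈ H ⊓ N := by
      refine Subgroup.mem_inf.mpr ⟨?_, n.2⟩
      have := H.mul_mem (H.inv_mem hn) ha
      simpa [mul_inv_rev] using this
    rw [hbot, Subgroup.mem_bot] at hmem
    exact Subtype.ext hmem
  · rintro rfl
    simpa using hn

/-! ### Injectivity of `t ↦ ⟨g i · t i⟩` on complements -/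

omit [N.Normal] in
/-- Two lifts `g i · t i`, `g i · t' i` generating the **same complement** `H` of `N` are equal:
`(g i t i)⁻¹ (g i t' i) = (t i)⁻¹ t' i ∈ H ⊓ N = ⊥` (uniqueness of the factorisation along a
complement). [cite: Rotman1995, Lemma 7.20 (ii)] -/
theorem lift_eq_of_closure_eq {ι : Type} (g : ι → G) {t t' : ι → N}
    (hbot : Subgroup.closure (Set.range fun i => g i * t i) ⊓ N = ⊥)
    (heq : Subgroup.closure (Set.range fun i => g i * t i) =
      Subgroup.closure (Set.range fun i => g i * t' i)) : t = t' := by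
  funext i
  set H := Subgroup.closure (Set.range fun i => g i * t i) with hHdef
  have ha : g i * t i ∈ H := Subgroup.subset_closure ⟨i, rfl⟩
  have hb : g i * t' i ∈ H := by rw [heq]; exact Subgroup.subset_closure ⟨i, rfl⟩
  have hmem : ((t i : G))⁻¹ * t' i ∈ H ⊓ N := by
    refine Subgroup.mem_inf.mpr ⟨?_, N.mul_mem (N.inv_mem (t i).2) (t' i).2⟩
    have := H.mul_mem (H.inv_mem ha) hb
    simpa [mul_inv_rev, mul_assoc] using this
  rw [hbot, Subgroup.mem_bot, inv_mul_eq_one] at hmem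
  exact Subtype.ext hmem

/-! ### Counting: non-generating lifts inject into crossed homomorphisms -/

/-- **Non-generating lifts inject into crossed homomorphisms.**  Let `N ⊴ G` be abelian and
minimal normal and let `g : ι → G` generate `G` modulo `N`.  Then the `t : ι → N` for which the
lifted family `g i · t i` does NOT generate `G` are at most as many as the crossed homomorphisms
`c : G → N` (`c (a b) = c a · a c b a⁻¹`): such a `t` generates a complement `H_t` of `N`
(`inf_eq_bot_of_sup_eq_top_of_ne_top`), `H_t` determines `t` (`lift_eq_of_closure_eq`), and `H_t`
is recovered from the crossed homomorphism `a ↦ (N-part of a⁻¹ along H_t)` as `{a | c a⁻¹ = 1}`.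
[cite: Gaschutz1955, Satz 1 (proof), p. 250] -/
theorem natCard_badLifts_le_natCard_crossedHom [Finite G] [IsMulCommutative N]
    (hmin : ∀ K : Subgroup G, K.Normal → K ≤ N → K = ⊥ ∨ K = N)
    {ι : Type} (g : ι → G) (hg : Subgroup.closure (Set.range g) ⊔ N = ⊤) :
    Nat.card {t : ι → N // Subgroup.closure (Set.range fun i => g i * t i) ≠ ⊤} ≤
      Nat.card {c : G → N // ∀ a b : G, (c (a * b) : G) = c a * (a * c b * a⁻¹)} := by
  classical
  -- every lifted family supplements `N`
  have hsup : ∀ t : ι → N, Subgroup.closure (Set.range fun i => g i * t i) ⊔ N = ⊤ := by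
    intro t
    refine top_le_iff.mp ?_
    rw [← hg]
    refine sup_le ?_ le_sup_right
    rw [Subgroup.closure_le]
    rintro _ ⟨i, rfl⟩
    have h1 : g i * t i ∈ Subgroup.closure (Set.range fun i => g i * t i) ⊔ N :=
      Subgroup.mem_sup_left (Subgroup.subset_closure ⟨i, rfl⟩)
    have h2 : ((t i : G))⁻¹ ∈ Subgroup.closure (Set.range fun i => g i * t i) ⊔ N :=
      Subgroup.mem_sup_right (N.inv_mem (t i).2)
    simpa using Subgroup.mul_mem _ h1 h2
  -- the `N`-part along the complement `H_t` of a bad `t`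
  have hex : ∀ (t : {t : ι → N // Subgroup.closure (Set.range fun i => g i * t i) ≠ ⊤}) (a : G),
      ∃ n : N, a * (n : G)⁻¹ ∈ Subgroup.closure (Set.range fun i => g i * t.1 i) := fun t a =>
    (existsUnique_mul_inv_mem (hsup t.1)
      (inf_eq_bot_of_sup_eq_top_of_ne_top hmin (hsup t.1) t.2) a).exists
  choose p hp using hex
  have hbot : ∀ t : {t : ι → N // Subgroup.closure (Set.range fun i => g i * t i) ≠ ⊤},
      Subgroup.closure (Set.range fun i => g i * t.1 i) ⊓ N = ⊥ := fun t =>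
    inf_eq_bot_of_sup_eq_top_of_ne_top hmin (hsup t.1) t.2
  have huniq : ∀ (t : {t : ι → N // Subgroup.closure (Set.range fun i => g i * t i) ≠ ⊤})
      (a : G) (n : N), a * (n : G)⁻¹ ∈ Subgroup.closure (Set.range fun i => g i * t.1 i) →
      n = p t a := fun t a n hn =>
    (existsUnique_mul_inv_mem (hsup t.1) (hbot t) a).unique hn (hp t a)
  -- the crossed homomorphism `c_t a := p t a⁻¹`
  have hcross : ∀ (t : {t : ι → N // Subgroup.closure (Set.range fun i => g i * t i) ≠ ⊤})
      (a b : G), ((p t (a * b)⁻¹ : N) : G) = p t a⁻¹ * (a * p t b⁻¹ * a⁻¹) := by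
    intro t a b
    set H := Subgroup.closure (Set.range fun i => g i * t.1 i)
    have hn : (a * (p t b⁻¹ : G) * a⁻¹) ∈ N := ‹N.Normal›.conj_mem _ (p t b⁻¹).2 a
    -- the candidate `N`-part of `(a b)⁻¹`
    let m : N := p t a⁻¹ * ⟨a * (p t b⁻¹ : G) * a⁻¹, hn⟩
    have hm : (a * b)⁻¹ * (m : G)⁻¹ ∈ H := by
      have h1 : a⁻¹ * ((p t a⁻¹ : N) : G)⁻¹ ∈ H := hp t a⁻¹
      have h2 : b⁻¹ * ((p t b⁻¹ : N) : G)⁻¹ ∈ H := hp t b⁻¹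
      have h3 := H.mul_mem h2 h1
      have hmG : ((m : N) : G) = (p t a⁻¹ : G) * (a * (p t b⁻¹ : G) * a⁻¹) := rfl
      rw [hmG]
      simpa [mul_inv_rev, mul_assoc] using h3
    have := huniq t (a * b)⁻¹ m hm
    rw [← this]
    rfl
  -- the injection
  let Φ : {t : ι → N // Subgroup.closure (Set.range fun i => g i * t i) ≠ ⊤} →
      {c : G → N // ∀ a b : G, (c (a * b) : G) = c a * (a * c b * a⁻¹)} :=
    fun t => ⟨fun a => p t a⁻¹, fun a b => hcross t a b⟩
  have hΦ : Function.Injective Φ := by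
    intro t t' htt'
    have hfun : (fun a => p t a⁻¹) = fun a => p t' a⁻¹ := congrArg Subtype.val htt'
    have hp_eq : ∀ a, p t a = p t' a := fun a => by
      simpa using congrFun hfun a⁻¹
    -- the complements coincide: `a ∈ H_t ↔ p t a = 1 ↔ p t' a = 1 ↔ a ∈ H_{t'}`
    have hHeq : Subgroup.closure (Set.range fun i => g i * t.1 i) =
        Subgroup.closure (Set.range fun i => g i * t'.1 i) := by
      ext a
      rw [mul_inv_mem_iff_of_complement (hbot t) (hp t a),
        mul_inv_mem_iff_of_complement (hbot t') (hp t' a), hp_eq a]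
    exact Subtype.ext (lift_eq_of_closure_eq g (hbot t) hHeq)
  haveI : Finite {c : G → N // ∀ a b : G, (c (a * b) : G) = c a * (a * c b * a⁻¹)} :=
    Subtype.finite
  exact Nat.card_le_card_of_injective Φ hΦ

/-- **Gaschütz lifting.**  Let `N ⊴ G` be abelian and minimal normal in the finite group `G`, let
`g : ι → G` (`ι` finite) generate `G` modulo `N`, and suppose there are FEWER crossed
homomorphisms `G → N` than `|N| ^ |ι|`.  Then for some `t : ι → N` the lifted family `g i · t i`
generates `G`. [cite: Gaschutz1955, Satz 1 (proof), p. 250] -/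
theorem exists_closure_eq_top_of_natCard_crossedHom_lt [Finite G] [IsMulCommutative N]
    (hmin : ∀ K : Subgroup G, K.Normal → K ≤ N → K = ⊥ ∨ K = N)
    {ι : Type} [Finite ι] (g : ι → G) (hg : Subgroup.closure (Set.range g) ⊔ N = ⊤)
    (hlt : Nat.card {c : G → N // ∀ a b : G, (c (a * b) : G) = c a * (a * c b * a⁻¹)} <
      Nat.card N ^ Nat.card ι) :
    ∃ t : ι → N, Subgroup.closure (Set.range fun i => g i * t i) = ⊤ := by
  classical
  by_contra hall
  push Not at hall
  have hle := natCard_badLifts_le_natCard_crossedHom hmin g hg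
  -- every `t` is bad, so the bad lifts are all of `ι → N`
  have hcard : Nat.card {t : ι → N // Subgroup.closure (Set.range fun i => g i * t i) ≠ ⊤} =
      Nat.card N ^ Nat.card ι := by
    rw [← Nat.card_fun]
    exact Nat.card_congr (Equiv.subtypeUnivEquiv hall)
  omega

end Literature.GroupTheory.Solvable
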